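import Literature.AlgebraicGeometry.Morphisms.SectionConormalHomComp          -- ★ p844469 (A-p01 g22): `appLE_appLE_apply'`, `appLE_congr_hom'` (+ ★ `SectionConormalChart`)
import Literature.AlgebraicGeometry.Morphisms.FibreChartRing                  -- ★ `fibreChartIso : T ⊗[R] ChartRing f W ≃+* Γ(Y, p ⁻¹ᵁ W)`, `fibreConst`
import Literature.RingTheory.Smooth.AugmentationIdealCotangentBaseChangeHom   -- (D2c-ii-alg) `baseChangeCotangentEquiv`, master square, `charpoly_eq_map_of_baseChange_comm`
import HarnessLib

/-!
# The conormal module of a section COMMUTES WITH BASE CHANGE, equivariantly: `𝒞_{e_T} ≅ T ⊗_R 𝒞_e` intertwines `w(v ×_R T)` with `T ⊗ w(v)`;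
# hence `charpoly (w(v_T)) = (charpoly w(v)).map (R → T)` (Görtz–Wedhorn II Rem. 17.14–17.15; EGA IV₄ (16.2.3), (16.4.9))

Topic `Literature/AlgebraicGeometry/Morphisms`, namespace `Literature.AlgebraicGeometry.Morphisms`.  DEFINITIONS (the chart algebra map `T ⊗_R Γ(X, W) → Γ(Y, U)` for
`U ⊆ p⁻¹W`, its `AlgEquiv` form for `U = p⁻¹W`, the cotangent base-change equivalence on a chart) and THEOREMS; no instance, no notation, no named fact, no `sorry`.
Cell `pub/hodgecm-mathlib` (D-0151), P6 «MOD», ROW 3 organ L3.1∕L3.2, brick **(D2c-ii)** of A-p01 (g22): the HONEST tensor base change of ★ `sectionConormalEndo`.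
SETTING (no `Over.pullback` in the hypotheses, as ★ `FibreChartRing`): `f : X → Spec R` with a section `e`, an affine `W` with `e⁻¹W = ⊤`; a commutative `R`-algebra `T`,
`hP : IsPullback p t f (Spec (R → T))`, the base-changed section `eY` (`heY`, `horig : eY ≫ p = Spec(R → T) ≫ e`); an `R`-endomorphism `v` of `X` fixing `e` with chart
datum `(h, hhv)`, and an endomorphism `vY` of `Y` over `T` with `vY ≫ p = p ≫ v` fixing `eY` (e.g. `v ×_R T`).
PRIOR ART IN THE TREE (cited, not restated): ★ `AbelianSchemes/AbelianSchemeChartBaseChange` (A-p14) has, for an ABELIAN SCHEME and the chart `W_T = p⁻¹W` only, the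
`T`-algebra form `AbelianScheme.fibreChartAlgHom` of ★ `fibreChartIso`, `sectionAug_baseChange_fibreChartIso` and the NON-equivariant `tensorCotangentChartEquiv` (with A-p11's ★
`tensorCotangentEquivAugIdealBaseChangeAugmentation`); NEW here: (i) general pointed `R`-scheme and an arbitrary sub-open `U ≤ p⁻¹W` (needed for the basic open `D(p^♯ h)`
through which ★ `sectionConormalEndo` acts — it equals `p⁻¹D(h)` only propositionally, `basicOpen_app_eq`), (ii) the EQUIVARIANCE square, (iii) the charpoly identity.
WHAT IS HERE: §1 `fibreChartAlgHomLE f p t hP W U hle` (`a ⊗ s ↦ t^♯(a)·p^♯(s)|_U`), `val_fibreChartAlgHomLE_eq_fibreChartIso`, `fibreChartAlgHomLE_bijective` (every `U = p⁻¹W`,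
by `subst`), **`fibreChartAlgEquiv`**; §2 **`sectionAug_fibreChartAlgHomLE`** (`e_Y^♯ ∘ Θ = (e^♯)_T`, ★ `baseChangeAugmentation`); §3 basic opens (`basicOpen_app_eq`,
`sectionAug_mk_app_eq_one`, `basicOpen_app_le_preimage`); §4 the two squares `fibreChartAlgEquiv_map_restrictAlgHom` (`Θ_h ∘ (T ⊗ v^♯) = vY^♯ ∘ Θ_W`) and
`fibreChartAlgEquiv_map_toAlgHom` (restrictions); §5 **`sectionCotangentBaseChangeEquiv : T ⊗[R] 𝒞_e(W) ≃ₗ[T] 𝒞_{e_Y}(p⁻¹W)`**, `Module.Free∕Finite` transports,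
**`sectionConormalEndo_baseChange_apply`** (`w(vY) (Φ z) = Φ ((T ⊗ w(v)) z)` — the master square of (D2c-ii-alg) twice + ★ `augCotangentLocalizationEquiv_sectionConormalEndo`),
**`charpoly_sectionConormalEndo_baseChange`**: `(w(vY)).charpoly = (w(v)).charpoly.map (algebraMap R T)`.  Consumer: `AbelianSchemes/AbelianSchemeCotangentCharpolyBaseChange`.

## References
* [GortzWedhorn2023] U. Görtz, T. Wedhorn, *Algebraic Geometry II* (2023): (17.3), Remark 17.14, Remark 17.15 (1).
* [EGAIV4] A. Grothendieck, *EGA IV₄*, Publ. Math. IHÉS 32 (1967): (16.2.3 (ii)), (16.4.9).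
* [GortzWedhorn2020] U. Görtz, T. Wedhorn, *Algebraic Geometry I*, 2nd ed. (2020): Prop. 4.20, Thm. 4.18, Remark 6.12 (2)–(3), §(2.10).
* [StacksProject] The Stacks Project, Tags 01JO, 00RU.
-/

set_option autoImplicit false

noncomputable section

-- `TopCat.Presheaf` is not reducible (as in ★ `SectionConormalChart`, ★ `FibreChartRing`).
set_option backward.isDefEq.respectTransparency false

open CategoryTheory CategoryTheory.Limits AlgebraicGeometry TopologicalSpace Opposite TensorProduct
open Literature.RingTheory.Smooth

universe u

namespace Literature.AlgebraicGeometry.Morphisms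

open ChartRing

variable {R : Type u} [CommRing R] {X : Scheme.{u}} (f : X ⟶ Spec (.of R))
  {T : Type u} [CommRing T] [Algebra R T] {Y : Scheme.{u}} (p : Y ⟶ X) (t : Y ⟶ Spec (.of T))
  (hP : IsPullback p t f (Spec.map (CommRingCat.ofHom (algebraMap R T))))

/-! ### Applied `appLE` bookkeeping (local copies of the private helpers of ★ `SectionConormalChart`) -/
section AppLE

variable {X' Y' Z : Scheme.{u}}

/-- `f^♯_{U ≤ V} (res x) = f^♯_{U' ≤ V} x` (Mathlib `Scheme.Hom.map_appLE`, applied). [folklore] -/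
private theorem map_appLE_apply (g : X' ⟶ Y') {U U' : Y'.Opens} {V : X'.Opens} (e : V ≤ g ⁻¹ᵁ U) (i : op U' ⟶ op U) (x : Γ(Y', U')) :
    g.appLE U V e (Y'.presheaf.map i x) = g.appLE U' V (e.trans ((Opens.map g.base).map i.unop).le) x := by
  have := congrArg (fun φ => φ.hom x) (Scheme.Hom.map_appLE g e i)
  simpa only [CommRingCat.hom_comp, RingHom.comp_apply] using this

/-- `res (f^♯_{U ≤ V} x) = f^♯_{U ≤ V'} x` (Mathlib `Scheme.Hom.appLE_map`, applied). [folklore] -/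
private theorem appLE_map_apply (g : X' ⟶ Y') {U : Y'.Opens} {V V' : X'.Opens} (e : V ≤ g ⁻¹ᵁ U) (i : op V ⟶ op V') (x : Γ(Y', U)) :
    X'.presheaf.map i (g.appLE U V e x) = g.appLE U V' (i.unop.le.trans e) x := by
  have := congrArg (fun φ => φ.hom x) (Scheme.Hom.appLE_map g e i)
  simpa only [CommRingCat.hom_comp, RingHom.comp_apply] using this

/-- `appTop = appLE ⊤ ⊤`, applied. [folklore] -/
private theorem appLE_top_top_apply_bc (g : Y' ⟶ Z) (x : Γ(Z, ⊤)) :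
    g.appLE ⊤ ⊤ (le_top : (⊤ : Y'.Opens) ≤ g ⁻¹ᵁ ⊤) x = g.appTop x := by
  change g.appLE ⊤ (g ⁻¹ᵁ ⊤) le_rfl x = g.appTop x
  rw [Scheme.Hom.appLE_eq_app]
  rfl

/-- `(Spec φ)^♯` on global sections through the two `ΓSpecIso`: `(Spec φ)^♯ (ι_R⁻¹ r) = ι_T⁻¹ (φ r)`. [folklore] -/
private theorem specMap_appTop_ΓSpecIso_inv (r : R) :
    (Spec.map (CommRingCat.ofHom (algebraMap R T))).appTop ((Scheme.ΓSpecIso (.of R)).inv r) =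
      (Scheme.ΓSpecIso (.of T)).inv (algebraMap R T r) := by
  have := congrArg (fun φ => φ.hom r) (Scheme.ΓSpecIso_inv_naturality (CommRingCat.ofHom (algebraMap R T)))
  simpa only [CommRingCat.hom_comp, RingHom.comp_apply, CommRingCat.hom_ofHom] using this.symm

/-- … and through the two `ΓSpecIso.hom`: `ι_T ((Spec φ)^♯ y) = φ (ι_R y)`. [folklore] -/
private theorem ΓSpecIso_hom_specMap_appTop (y : Γ(Spec (.of R), ⊤)) :
    (Scheme.ΓSpecIso (.of T)).hom ((Spec.map (CommRingCat.ofHom (algebraMap R T))).appTop y) =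
      algebraMap R T ((Scheme.ΓSpecIso (.of R)).hom y) := by
  have := congrArg (fun φ => φ.hom y) (Scheme.ΓSpecIso_naturality (CommRingCat.ofHom (algebraMap R T)))
  simpa only [CommRingCat.hom_comp, RingHom.comp_apply, CommRingCat.hom_ofHom] using this
end AppLE

/-! ## §1 The chart algebra map `T ⊗_R Γ(X, W) → Γ(Y, U)` for `U ⊆ p⁻¹W`, and the chart isomorphism for `U = p⁻¹W` -/
section Chart

variable (W : X.Opens) (U : Y.Opens) (hle : U ≤ p ⁻¹ᵁ W)

include hP in
/-- `p^♯(f^♯ r)|_U = t^♯((R → T) r)|_U`: the cartesian square commutes on functions. [cite: GortzWedhorn2020, Prop. 4.20] -/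
theorem appLE_val_algebraMap (r : R) :
    p.appLE W U hle (val (algebraMap R (ChartRing f W) r)) = val (algebraMap T (ChartRing t U) (algebraMap R T r)) := by
  rw [val_algebraMap, val_algebraMap, appLE_appLE_apply', appLE_congr_hom' hP.w ⊤ U _ (fun _ _ => trivial),
    ← specMap_appTop_ΓSpecIso_inv (T := T), ← appLE_top_top_apply_bc, appLE_appLE_apply']

/-- **`Θ : T ⊗_R Γ(X, W) → Γ(Y, U)`, `a ⊗ s ↦ t^♯(a)|_U · p^♯(s)|_U`** for an open `U ⊆ p⁻¹W` of `Y = X ×_R T`, as a `T`-algebra map (Mathlib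
`Algebra.TensorProduct.lift` of `t^♯` and `p^♯`; for `U = p⁻¹W` it is the chart isomorphism ★ `fibreChartIso`, §1 below). [cite: GortzWedhorn2020, Prop. 4.20 and Thm. 4.18] -/
def fibreChartAlgHomLE : T ⊗[R] ChartRing f W →ₐ[T] ChartRing t U :=
  letI : Algebra R (ChartRing t U) := ((algebraMap T (ChartRing t U)).comp (algebraMap R T)).toAlgebra
  haveI : IsScalarTower R T (ChartRing t U) := IsScalarTower.of_algebraMap_eq fun _ => rfl
  Algebra.TensorProduct.lift (Algebra.ofId T (ChartRing t U))
    { toRingHom := (mk t U).comp ((p.appLE W U hle).hom.comp (val (f := f) (W := W)))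
      commutes' := fun r => val_injective t U (by
        change p.appLE W U hle (val (algebraMap R (ChartRing f W) r)) = val (algebraMap T (ChartRing t U) (algebraMap R T r))
        exact appLE_val_algebraMap f p t hP W U hle r) }
    fun _ _ => Commute.all _ _

/-- **`Θ (a ⊗ s) = t^♯(a) · p^♯(s)`.** [cite: GortzWedhorn2020, Prop. 4.20] -/
theorem fibreChartAlgHomLE_tmul (a : T) (s : ChartRing f W) :
    fibreChartAlgHomLE f p t hP W U hle (a ⊗ₜ[R] s) = algebraMap T (ChartRing t U) a * mk t U (p.appLE W U hle (val s)) := by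
  letI : Algebra R (ChartRing t U) := ((algebraMap T (ChartRing t U)).comp (algebraMap R T)).toAlgebra
  haveI : IsScalarTower R T (ChartRing t U) := IsScalarTower.of_algebraMap_eq fun _ => rfl
  rw [fibreChartAlgHomLE, Algebra.TensorProduct.lift_tmul]
  rfl

/-- The same on underlying sections: `val (Θ (a ⊗ s)) = t^♯(a)|_U · p^♯(s)|_U`. [cite: GortzWedhorn2020, Prop. 4.20] -/
theorem val_fibreChartAlgHomLE_tmul (a : T) (s : ChartRing f W) :
    val (fibreChartAlgHomLE f p t hP W U hle (a ⊗ₜ[R] s)) =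
      t.appLE ⊤ U le_top ((Scheme.ΓSpecIso (.of T)).inv a) * p.appLE W U hle (val s) := by
  rw [fibreChartAlgHomLE_tmul, map_mul, val_algebraMap, val_mk]

/-- `Θ (1 ⊗ s) = p^♯(s)|_U`. [cite: GortzWedhorn2020, Prop. 4.20] -/
theorem fibreChartAlgHomLE_one_tmul (s : ChartRing f W) :
    fibreChartAlgHomLE f p t hP W U hle (1 ⊗ₜ[R] s) = mk t U (p.appLE W U hle (val s)) := by
  rw [fibreChartAlgHomLE_tmul, map_one, one_mul]

variable {W} (hW : IsAffineOpen W)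

include hW in
/-- For `U = p⁻¹W` (`W` affine) the chart algebra map IS ★ `fibreChartIso` (on underlying sections). [cite: GortzWedhorn2020, Prop. 4.20 and Thm. 4.18] -/
theorem val_fibreChartAlgHomLE_eq_fibreChartIso (z : T ⊗[R] ChartRing f W) :
    val (fibreChartAlgHomLE f p t hP W (p ⁻¹ᵁ W) le_rfl z) = fibreChartIso f p t hP hW z := by
  induction z using TensorProduct.induction_on with
  | zero => simp only [map_zero]
  | tmul a s => rw [val_fibreChartAlgHomLE_tmul, fibreChartIso_tmul, fibreConst_apply, Scheme.Hom.app_eq_appLE]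
  | add x y hx hy => simp only [map_add, hx, hy]

include hW in
/-- **`Θ : T ⊗_R Γ(X, W) → Γ(Y, U)` is bijective for every `U = p⁻¹W`**, `W` affine (★ `fibreChartIso`; the equality of opens enters by `subst`, so
`U = Y.basicOpen (p^♯ h) = p⁻¹ D(h)` needs no transport). [cite: GortzWedhorn2020, Prop. 4.20 and Thm. 4.18] [cite: StacksProject, Tag 01JO] -/
theorem fibreChartAlgHomLE_bijective {U : Y.Opens} (hU : U = p ⁻¹ᵁ W) :
    Function.Bijective (fibreChartAlgHomLE f p t hP W U hU.le) := by
  subst hU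
  have hfun : (fun z => fibreChartAlgHomLE f p t hP W (p ⁻¹ᵁ W) le_rfl z) = fun z => mk t (p ⁻¹ᵁ W) (fibreChartIso f p t hP hW z) :=
    funext fun z => val_injective t _ (by rw [val_mk]; exact val_fibreChartAlgHomLE_eq_fibreChartIso f p t hP hW z)
  change Function.Bijective (fun z => fibreChartAlgHomLE f p t hP W (p ⁻¹ᵁ W) le_rfl z)
  rw [hfun]
  exact (show Function.Bijective (mk t (p ⁻¹ᵁ W)) from ⟨fun _ _ hab => hab, fun y => ⟨y, rfl⟩⟩).comp
    (fibreChartIso f p t hP hW).bijective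

/-- **The chart isomorphism `Θ_U : T ⊗_R Γ(X, W) ≃ₐ[T] Γ(Y, U)` for `U = p⁻¹W`** (`W` affine) as a `T`-ALGEBRA isomorphism.
[cite: GortzWedhorn2020, Prop. 4.20 and Thm. 4.18] [cite: StacksProject, Tag 01JO] -/
def fibreChartAlgEquiv {U : Y.Opens} (hU : U = p ⁻¹ᵁ W) : T ⊗[R] ChartRing f W ≃ₐ[T] ChartRing t U :=
  AlgEquiv.ofBijective (fibreChartAlgHomLE f p t hP W U hU.le) (fibreChartAlgHomLE_bijective f p t hP hW hU)

/-- Unfolding of `fibreChartAlgEquiv`. [cite: GortzWedhorn2020, Prop. 4.20] -/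
theorem fibreChartAlgEquiv_apply {U : Y.Opens} (hU : U = p ⁻¹ᵁ W) (z : T ⊗[R] ChartRing f W) :
    fibreChartAlgEquiv f p t hP hW hU z = fibreChartAlgHomLE f p t hP W U hU.le z :=
  rfl
end Chart

/-! ## §2 Sections: `e_Y^♯ ∘ Θ = (e^♯)_T` -/
section Section

variable (e : Spec (.of R) ⟶ X) (he : e ≫ f = 𝟙 _) (eY : Spec (.of T) ⟶ Y) (heY : eY ≫ t = 𝟙 _)
  (horig : eY ≫ p = Spec.map (CommRingCat.ofHom (algebraMap R T)) ≫ e)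

include horig in
/-- `eY⁻¹ U = ⊤` for every `U ⊇ p⁻¹O` with `e⁻¹O = ⊤` (the square of the two sections commutes). [cite: GortzWedhorn2023, Remark 17.14] -/
theorem preimage_eq_top_of_le (O : X.Opens) (heO : e ⁻¹ᵁ O = ⊤) {U : Y.Opens} (hU : p ⁻¹ᵁ O ≤ U) : eY ⁻¹ᵁ U = ⊤ := by
  refine top_le_iff.1 fun x _ => hU ?_
  change (eY ≫ p).base x ∈ O
  rw [horig]
  change (Spec.map (CommRingCat.ofHom (algebraMap R T))).base x ∈ e ⁻¹ᵁ O
  rw [heO]; trivial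

variable {W : X.Opens} (heW : e ⁻¹ᵁ W = ⊤) (U : Y.Opens) (hle : U ≤ p ⁻¹ᵁ W) (heU : eY ⁻¹ᵁ U = ⊤)

include horig in
/-- **`e_Y^♯ (p^♯ s|_U) = (R → T) (e^♯ s)`** for `s ∈ Γ(X, W)`. [cite: GortzWedhorn2023, Remark 17.14] -/
theorem sectionAug_mk_appLE (s : ChartRing f W) :
    sectionAug t eY heY heU (mk t U (p.appLE W U hle (val s))) = algebraMap R T (sectionAug f e he heW s) := by
  have hle' : (⊤ : (Spec (.of T)).Opens) ≤ (Spec.map (CommRingCat.ofHom (algebraMap R T)) ≫ e) ⁻¹ᵁ W := fun x _ => by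
    change (Spec.map (CommRingCat.ofHom (algebraMap R T))).base x ∈ e ⁻¹ᵁ W
    rw [heW]; trivial
  rw [sectionAug_apply, sectionAug_apply, val_mk, appLE_appLE_apply', appLE_congr_hom' horig W ⊤ _ hle',
    ← ΓSpecIso_hom_specMap_appTop (T := T), ← appLE_top_top_apply_bc, appLE_appLE_apply']

include horig in
/-- **`e_Y^♯ ∘ Θ = (e^♯)_T`**: the chart algebra map intertwines the augmentation of the base-changed section with the base change ★
`baseChangeAugmentation` of the augmentation of the section. [cite: GortzWedhorn2023, Remark 17.14 and Remark 17.15 (1)] [cite: EGAIV4, (16.2.3) and (16.4.9)] -/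
theorem sectionAug_fibreChartAlgHomLE (z : T ⊗[R] ChartRing f W) :
    sectionAug t eY heY heU (fibreChartAlgHomLE f p t hP W U hle z) = baseChangeAugmentation (sectionAug f e he heW) T z := by
  induction z using TensorProduct.induction_on with
  | zero => simp only [map_zero]
  | tmul a s =>
    rw [fibreChartAlgHomLE_tmul, map_mul, AlgHom.commutes, Algebra.algebraMap_self, RingHom.id_apply,
      sectionAug_mk_appLE f p t e he eY heY horig heW U hle heU, baseChangeAugmentation_tmul]
  | add x y hx hy => simp only [map_add, hx, hy]

include horig in
/-- The same as an identity of `T`-algebra maps, in the shape consumed by (D2c-ii-alg) `baseChangeCotangentEquiv`. [cite: GortzWedhorn2023, Remark 17.15 (1)] -/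
theorem sectionAug_comp_fibreChartAlgEquiv (hW : IsAffineOpen W) (hU : U = p ⁻¹ᵁ W) :
    (sectionAug t eY heY heU).comp (fibreChartAlgEquiv f p t hP hW hU : T ⊗[R] ChartRing f W →ₐ[T] ChartRing t U) =
      baseChangeAugmentation (sectionAug f e he heW) T :=
  AlgHom.ext fun z => sectionAug_fibreChartAlgHomLE f p t hP e he eY heY horig heW U hU.le heU z
end Section

/-! ## §3 Basic opens: `Y.basicOpen (p^♯ h) = p⁻¹ D(h)` -/
section BasicOpen

variable {W : X.Opens} (h : ChartRing f W)

omit [Algebra R T] in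
/-- **`D(p^♯ h) = p⁻¹ D(h)`** (Mathlib `Scheme.preimage_basicOpen`). [cite: GortzWedhorn2020, §(2.10)] -/
theorem basicOpen_app_eq : Y.basicOpen (val (mk t (p ⁻¹ᵁ W) (p.app W (val h)))) = p ⁻¹ᵁ X.basicOpen (val h) := by
  rw [val_mk]
  exact (Scheme.preimage_basicOpen p (val h)).symm

omit [Algebra R T] in
/-- `D(p^♯ h) ≤ p⁻¹ D(h)`. [cite: GortzWedhorn2020, §(2.10)] -/
theorem basicOpen_app_le : Y.basicOpen (val (mk t (p ⁻¹ᵁ W) (p.app W (val h)))) ≤ p ⁻¹ᵁ X.basicOpen (val h) :=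
  (basicOpen_app_eq f p t h).le

variable (e : Spec (.of R) ⟶ X) (he : e ≫ f = 𝟙 _) (eY : Spec (.of T) ⟶ Y) (heY : eY ≫ t = 𝟙 _)
  (horig : eY ≫ p = Spec.map (CommRingCat.ofHom (algebraMap R T)) ≫ e) (heW : e ⁻¹ᵁ W = ⊤) (heWY : eY ⁻¹ᵁ (p ⁻¹ᵁ W) = ⊤)

include horig in
/-- `e_Y^♯ (p^♯ h) = (R → T)(e^♯ h)`; in particular **`e^♯ h = 1 ⇒ e_Y^♯ (p^♯ h) = 1`**. [cite: GortzWedhorn2023, (17.3)] -/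
theorem sectionAug_mk_app_eq_one (hh : sectionAug f e he heW h = 1) : sectionAug t eY heY heWY (mk t (p ⁻¹ᵁ W) (p.app W (val h))) = 1 := by
  rw [Scheme.Hom.app_eq_appLE, sectionAug_mk_appLE f p t e he eY heY horig heW (p ⁻¹ᵁ W) le_rfl heWY, hh, map_one]

omit [Algebra R T] in
/-- **`D(p^♯ h) ⊆ vY⁻¹ p⁻¹ W`** when `D(h) ⊆ v⁻¹ W` and `vY ≫ p = p ≫ v`. [cite: GortzWedhorn2023, Remark 17.14] -/
theorem basicOpen_app_le_preimage (v : X ⟶ X) (hhv : X.basicOpen (val h) ≤ v ⁻¹ᵁ W) (vY : Y ⟶ Y) (hpv : vY ≫ p = p ≫ v) :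
    Y.basicOpen (val (mk t (p ⁻¹ᵁ W) (p.app W (val h)))) ≤ vY ⁻¹ᵁ (p ⁻¹ᵁ W) := by
  rw [basicOpen_app_eq]
  intro x hx
  change x ∈ (vY ≫ p) ⁻¹ᵁ W
  rw [hpv]
  exact hhv hx
end BasicOpen

/-! ## §4 The two squares: `Θ_h ∘ (T ⊗ v^♯) = vY^♯ ∘ Θ_W` and `Θ_h ∘ (T ⊗ res) = res ∘ Θ_W` -/
section Squares

variable {W : X.Opens} (hW : IsAffineOpen W) (h : ChartRing f W) (v : X ⟶ X) (hv : v ≫ f = f) (hhv : X.basicOpen (val h) ≤ v ⁻¹ᵁ W)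
  (vY : Y ⟶ Y) (hvY : vY ≫ t = t) (hpv : vY ≫ p = p ≫ v)

include hpv hvY in
/-- **`Θ_h (a ⊗ v^♯ s) = vY^♯ (Θ_W (a ⊗ s))`**: the chart isomorphisms intertwine `T ⊗ v^♯` (★ `restrictAlgHom` on `X`) with `vY^♯` (on `Y`).
[cite: GortzWedhorn2023, Remark 17.14] [cite: GortzWedhorn2020, Prop. 4.20] -/
theorem fibreChartAlgEquiv_map_restrictAlgHom (z : T ⊗[R] ChartRing f W) :
    fibreChartAlgEquiv f p t hP (hW.basicOpen (val h)) (basicOpen_app_eq f p t h)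
        (Algebra.TensorProduct.map (AlgHom.id T T) (restrictAlgHom f v hv h hhv) z) =
      restrictAlgHom t vY hvY (mk t (p ⁻¹ᵁ W) (p.app W (val h))) (basicOpen_app_le_preimage f p t h v hhv vY hpv)
        (fibreChartAlgEquiv f p t hP hW rfl z) := by
  induction z using TensorProduct.induction_on with
  | zero => simp only [map_zero]
  | tmul a s =>
    apply val_injective t
    rw [Algebra.TensorProduct.map_tmul, AlgHom.id_apply, fibreChartAlgEquiv_apply, fibreChartAlgEquiv_apply, val_fibreChartAlgHomLE_tmul,
      val_restrictAlgHom, val_restrictAlgHom, val_fibreChartAlgHomLE_tmul, map_mul]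
    congr 1
    · rw [appLE_appLE_apply']
      exact appLE_congr_hom' hvY.symm _ _ _ _ _
    · rw [appLE_appLE_apply', appLE_appLE_apply']
      exact appLE_congr_hom' hpv.symm _ _ _ _ _
  | add x y hx hy => simp only [map_add, hx, hy]

/-- **`Θ_h (a ⊗ s|_{D(h)}) = (Θ_W (a ⊗ s))|_{D(p^♯h)}`**: the chart isomorphisms intertwine the restrictions `Γ(X, W) → Γ(X, D(h))` and
`Γ(Y, p⁻¹W) → Γ(Y, D(p^♯ h))` (the localisation maps of ★ `isLocalization_away`). [cite: GortzWedhorn2020, §(2.10) and Prop. 4.20] -/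
theorem fibreChartAlgEquiv_map_toAlgHom (z : T ⊗[R] ChartRing f W) :
    fibreChartAlgEquiv f p t hP (hW.basicOpen (val h)) (basicOpen_app_eq f p t h)
        (Algebra.TensorProduct.map (AlgHom.id T T) (IsScalarTower.toAlgHom R (ChartRing f W) (ChartRing f (X.basicOpen (val h)))) z) =
      algebraMap (ChartRing t (p ⁻¹ᵁ W)) (ChartRing t (Y.basicOpen (val (mk t (p ⁻¹ᵁ W) (p.app W (val h))))))
        (fibreChartAlgEquiv f p t hP hW rfl z) := by
  induction z using TensorProduct.induction_on with
  | zero => simp only [map_zero]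
  | tmul a s =>
    apply val_injective t
    rw [Algebra.TensorProduct.map_tmul, AlgHom.id_apply, fibreChartAlgEquiv_apply, fibreChartAlgEquiv_apply, val_fibreChartAlgHomLE_tmul,
      IsScalarTower.coe_toAlgHom', val_algebraMap_basicOpen, map_appLE_apply]
    conv_rhs => rw [val_algebraMap_basicOpen, val_fibreChartAlgHomLE_tmul, map_mul, appLE_map_apply, appLE_map_apply]
  | add x y hx hy => simp only [map_add, hx, hy]
end Squares

/-! ## §5 The cotangent base-change equivalence on a chart; equivariance; characteristic polynomials -/
section Cotangent

variable (e : Spec (.of R) ⟶ X) (he : e ≫ f = 𝟙 _) {W : X.Opens} (hW : IsAffineOpen W) (heW : e ⁻¹ᵁ W = ⊤)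
  (eY : Spec (.of T) ⟶ Y) (heY : eY ≫ t = 𝟙 _) (horig : eY ≫ p = Spec.map (CommRingCat.ofHom (algebraMap R T)) ≫ e)
  (heWY : eY ⁻¹ᵁ (p ⁻¹ᵁ W) = ⊤)

/-- **`Φ_W : T ⊗_R 𝒞_e(W) ≃ₗ[T] 𝒞_{e_Y}(p⁻¹W)`** — the conormal module of the section on the chart `W` commutes with the base change `R → T`
((D2c-ii-alg) `baseChangeCotangentEquiv` at the augmented chart isomorphism `Θ_W`). [cite: GortzWedhorn2023, Remark 17.15 (1)] [cite: EGAIV4, (16.2.3) and (16.4.9)] -/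
def sectionCotangentBaseChangeEquiv :
    T ⊗[R] (augIdeal (sectionAug f e he heW)).Cotangent ≃ₗ[T] (augIdeal (sectionAug t eY heY heWY)).Cotangent :=
  baseChangeCotangentEquiv (sectionAug f e he heW) T (sectionAug t eY heY heWY) (fibreChartAlgEquiv f p t hP hW rfl)
    (sectionAug_comp_fibreChartAlgEquiv f p t hP e he eY heY horig heW (p ⁻¹ᵁ W) heWY hW rfl)

include hP horig hW in
/-- `𝒞_e(W)` free over `R` ⇒ `𝒞_{e_Y}(p⁻¹W)` free over `T`. [cite: EGAIV4, (16.2.3) and (16.4.9)] -/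
theorem free_cotangent_sectionAug_baseChange [Module.Free R (augIdeal (sectionAug f e he heW)).Cotangent] :
    Module.Free T (augIdeal (sectionAug t eY heY heWY)).Cotangent :=
  Module.Free.of_equiv (sectionCotangentBaseChangeEquiv f p t hP e he hW heW eY heY horig heWY)

include hP horig hW in
/-- `𝒞_e(W)` finite over `R` ⇒ `𝒞_{e_Y}(p⁻¹W)` finite over `T`. [cite: EGAIV4, (16.2.3) and (16.4.9)] -/
theorem finite_cotangent_sectionAug_baseChange [Module.Finite R (augIdeal (sectionAug f e he heW)).Cotangent] :
    Module.Finite T (augIdeal (sectionAug t eY heY heWY)).Cotangent :=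
  Module.Finite.equiv (sectionCotangentBaseChangeEquiv f p t hP e he hW heW eY heY horig heWY)

variable (v : X ⟶ X) (hv : v ≫ f = f) (hev : e ≫ v = e) (h : ChartRing f W) (hhv : X.basicOpen (val h) ≤ v ⁻¹ᵁ W)
  (hh : sectionAug f e he heW h = 1) (vY : Y ⟶ Y) (hvY : vY ≫ t = t) (hevY : eY ≫ vY = eY) (hpv : vY ≫ p = p ≫ v)

/-- **EQUIVARIANCE — `w(vY) (Φ_W z) = Φ_W ((T ⊗ w(v)) z)`** (`vY` through the chart datum `p^♯ h`, `v` through `h`): the master square of (D2c-ii-alg) twice (for `(v^♯, vY^♯)`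
and for the localisation maps) and ★ `augCotangentLocalizationEquiv_sectionConormalEndo`. [cite: GortzWedhorn2023, Remark 17.14 and Remark 17.15 (1)] [cite: EGAIV4, (16.2.3) and (16.4.9)] -/
theorem sectionConormalEndo_baseChange_apply (z : T ⊗[R] (augIdeal (sectionAug f e he heW)).Cotangent) :
    sectionConormalEndo t eY heY heWY vY hvY hevY (mk t (p ⁻¹ᵁ W) (p.app W (val h))) (basicOpen_app_le_preimage f p t h v hhv vY hpv)
        (isAffineOpen_preimage_of_isPullback f p t hP hW) (sectionAug_mk_app_eq_one f p t h e he eY heY horig heW heWY hh)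
        (sectionCotangentBaseChangeEquiv f p t hP e he hW heW eY heY horig heWY z) =
      sectionCotangentBaseChangeEquiv f p t hP e he hW heW eY heY horig heWY
        ((sectionConormalEndo f e he heW v hv hev h hhv hW hh).baseChange T z) := by
  -- notation
  haveI := ChartRing.isLocalization_away f hW h
  haveI := ChartRing.isLocalization_away t (isAffineOpen_preimage_of_isPullback f p t hP hW) (mk t (p ⁻¹ᵁ W) (p.app W (val h)))
  have hhY := sectionAug_mk_app_eq_one f p t h e he eY heY horig heW heWY hh
  have heWh : e ⁻¹ᵁ X.basicOpen (val h) = ⊤ := preimage_basicOpen_eq_top f e he heW h hh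
  have heWYh : eY ⁻¹ᵁ Y.basicOpen (val (mk t (p ⁻¹ᵁ W) (p.app W (val h)))) = ⊤ :=
    preimage_basicOpen_eq_top t eY heY heWY _ hhY
  -- the chart isomorphism at the level `D(h)` and its augmentation compatibility
  have hΘh := sectionAug_comp_fibreChartAlgEquiv f p t hP e he eY heY horig heWh (Y.basicOpen (val (mk t (p ⁻¹ᵁ W) (p.app W (val h)))))
    heWYh (hW.basicOpen (val h)) (basicOpen_app_eq f p t h)
  -- the two master squares
  have sq1 := baseChangeCotangentEquiv_naturality (sectionAug f e he heW) (sectionAug f e he heWh) T (sectionAug t eY heY heWY)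
    (sectionAug t eY heY heWYh) (fibreChartAlgEquiv f p t hP hW rfl)
    (sectionAug_comp_fibreChartAlgEquiv f p t hP e he eY heY horig heW (p ⁻¹ᵁ W) heWY hW rfl) _ hΘh
    (restrictAlgHom f v hv h hhv) (AlgHom.ext (sectionAug_restrictAlgHom f e he heW v hv hev h hhv hh))
    (restrictAlgHom t vY hvY _ (basicOpen_app_le_preimage f p t h v hhv vY hpv))
    (AlgHom.ext (sectionAug_restrictAlgHom t eY heY heWY vY hvY hevY _ _ hhY))
    (fibreChartAlgEquiv_map_restrictAlgHom f p t hP hW h v hv hhv vY hvY hpv)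
  have sq2 := baseChangeCotangentEquiv_naturality (sectionAug f e he heW) (sectionAug f e he heWh) T (sectionAug t eY heY heWY)
    (sectionAug t eY heY heWYh) (fibreChartAlgEquiv f p t hP hW rfl)
    (sectionAug_comp_fibreChartAlgEquiv f p t hP e he eY heY horig heW (p ⁻¹ᵁ W) heWY hW rfl) _ hΘh
    (IsScalarTower.toAlgHom R _ _) (AlgHom.ext (sectionAug_algebraMap f e he heW h hh))
    (IsScalarTower.toAlgHom T _ _) (AlgHom.ext (sectionAug_algebraMap t eY heY heWY _ hhY))
    (fibreChartAlgEquiv_map_toAlgHom f p t hP hW h)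
  -- apply the (injective) localisation isomorphism on `Y`
  apply (augCotangentLocalizationEquiv (sectionAug t eY heY heWY) (sectionAug t eY heY heWYh)
    (sectionAug_algebraMap t eY heY heWY _ hhY) _ hhY).injective
  rw [augCotangentLocalizationEquiv_sectionConormalEndo]
  change _ = augCotangentLocalizationEquiv _ _ _ _ _ (sectionCotangentBaseChangeEquiv f p t hP e he hW heW eY heY horig heWY _)
  rw [sectionCotangentBaseChangeEquiv, ← sq1]
  conv_rhs => rw [← LinearEquiv.coe_toLinearMap, augCotangentLocalizationEquiv_toLinearMap]
  rw [← sq2]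
  congr 1
  rw [sectionConormalEndo, ← LinearMap.comp_apply, ← LinearMap.baseChange_comp,
    ← augCotangentLocalizationEquiv_toLinearMap (sectionAug f e he heW) (sectionAug f e he heWh) (sectionAug_algebraMap f e he heW h hh) h hh,
    ← LinearMap.comp_assoc, ← LinearEquiv.coe_trans, LinearEquiv.symm_trans_self, LinearEquiv.refl_toLinearMap, LinearMap.id_comp]

/-- The equivariance as an identity of `T`-linear maps: `w(vY) ∘ Φ_W = Φ_W ∘ (T ⊗ w(v))`. [cite: GortzWedhorn2023, Remark 17.14 and Remark 17.15 (1)] -/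
theorem sectionConormalEndo_comp_sectionCotangentBaseChangeEquiv :
    sectionConormalEndo t eY heY heWY vY hvY hevY (mk t (p ⁻¹ᵁ W) (p.app W (val h))) (basicOpen_app_le_preimage f p t h v hhv vY hpv)
        (isAffineOpen_preimage_of_isPullback f p t hP hW) (sectionAug_mk_app_eq_one f p t h e he eY heY horig heW heWY hh) ∘ₗ
        (sectionCotangentBaseChangeEquiv f p t hP e he hW heW eY heY horig heWY).toLinearMap =
      (sectionCotangentBaseChangeEquiv f p t hP e he hW heW eY heY horig heWY).toLinearMap ∘ₗ
        (sectionConormalEndo f e he heW v hv hev h hhv hW hh).baseChange T :=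
  LinearMap.ext fun z => sectionConormalEndo_baseChange_apply f p t hP e he hW heW eY heY horig heWY v hv hev h hhv hh vY hvY hevY hpv z

/-- **THE COTANGENT CHARACTERISTIC POLYNOMIAL COMMUTES WITH BASE CHANGE**: `(w(vY)).charpoly = (w(v)).charpoly.map (R → T)` for `𝒞_e(W)` free of finite rank over `R`
(any chart datum on `Y` gives the same polynomial, ★ `charpoly_sectionConormalEndo_eq_of_charts`). [cite: GortzWedhorn2023, Remark 17.15 (1)] [cite: GortzWedhorn2020, Remark 6.12 (2)–(3)] -/
theorem charpoly_sectionConormalEndo_baseChange [Module.Free R (augIdeal (sectionAug f e he heW)).Cotangent]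
    [Module.Finite R (augIdeal (sectionAug f e he heW)).Cotangent] [Module.Free T (augIdeal (sectionAug t eY heY heWY)).Cotangent]
    [Module.Finite T (augIdeal (sectionAug t eY heY heWY)).Cotangent] :
    (sectionConormalEndo t eY heY heWY vY hvY hevY (mk t (p ⁻¹ᵁ W) (p.app W (val h))) (basicOpen_app_le_preimage f p t h v hhv vY hpv)
        (isAffineOpen_preimage_of_isPullback f p t hP hW) (sectionAug_mk_app_eq_one f p t h e he eY heY horig heW heWY hh)).charpoly =
      (sectionConormalEndo f e he heW v hv hev h hhv hW hh).charpoly.map (algebraMap R T) := by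
  have := charpoly_eq_map_of_baseChange_comm T (sectionCotangentBaseChangeEquiv f p t hP e he hW heW eY heY horig heWY)
    (sectionConormalEndo f e he heW v hv hev h hhv hW hh) _
    (sectionConormalEndo_comp_sectionCotangentBaseChangeEquiv f p t hP e he hW heW eY heY horig heWY v hv hev h hhv hh vY hvY hevY hpv)
  convert this using 2
end Cotangent

end Literature.AlgebraicGeometry.Morphisms

end
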